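import Summits.HodgeConjecture.HodgeConjecture.Theorems.Ring2HypothesesDescentAbsoluteLefschetzStable
import Summits.HodgeConjecture.HodgeConjecture.Theorems.Ring2HypothesesDescentAbsolutePrimitiveRow
import Summits.HodgeConjecture.HodgeConjecture.Theorems.Ring2AbelianAllSpreadPrimitiveMiddle
import HarnessLib

/-!
# Ring 2 — hypotheses layer, descent axis: ROW b06 IS "LEFSCHETZ-PRIMITIVE ABSOLUTE HODGE CLASSES IN THE MIDDLE DEGREE
# OF EVEN-DIMENSIONAL ABELIAN VARIETIES ARE ALGEBRAIC" — the absolute twin of AbelianAll part XXVIII (modulo (N)+(E)+(c))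

HONEST FRAMING (page 1, verbatim the cell's standing line): **research route conditional on HC_CM; not a
corollary; Q11.4-sentence-2 already refuted in dim ≥ 3.** Nothing in this file proves a case of the Hodge conjecture;
nothing discharges the binder of record b06 `Ring2.Hypotheses.AbsoluteHodgeImpliesAlgebraicAV` ("absolute Hodge classes
on complex abelian varieties are algebraic", `Ring2HypothesesDescent.lean` :73; OPEN, `≡ HC_AV` modulo Deligne's Main
Theorem 2.11 = fact c1); the binder table's numbers do not move. `HC_CM` (`Theses.RankFourFaces.CMAbelianHodge`) does not
occur in this file; `HC_AV` occurs only inside AbelianAll part XXVIII's equivalence in §3 and is never asserted.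

Hodge ladder STAGE 3, `BINDER-OWNERS.md` row **b06**, seat `ring2-b06` (gen 71), fourth file of the gen. Gens 69–70 of
this seat gave row b06 `↔` its MIDDLE-DEGREE slice (`absoluteHodgeImpliesAlgebraicAV_iff_middleDegree_of_canonical`) and
the second file of this gen gave row b06 `↔` its EVEN-PRIMITIVE form; their INTERSECTION — primitive AND middle, the
binder of AbelianAll part XXVIII (`HC_AV_iff_forall_primitiveMiddle`, ab-spread-1 gen 32, by DEFECT INDUCTION over
ring2-b02's primitive one-step lift, gen 36; count once THEIRS) — needed the lift `L_{pr₁^*η} pr₁^*c − (r+1)·L_{pr₂^*K_E} pr₁^*c`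
of a PRIMITIVE absolute Hodge class of LOW degree to be absolute Hodge. The third file of this gen supplies exactly that
(`isAbsoluteHodgeClass_primitiveLift_of_canonical`: full Lefschetz stability of absolute Hodge classes modulo (N)
`chartConjugation_canonical`, (E) existence of conjugates, (c) `deligne1982_lefschetz_absoluteHodge_iff`). So:

* §1 `mem_algebraicClasses_of_absoluteHodge_primitive_of_forall_primitiveMiddle` — XXVIII's defect induction READ ON
  ABSOLUTE HODGE CLASSES: if on every complex abelian variety `B` of dimension `2m ≥ 4` and for every polarisation class
  `θ`, every θ-primitive ABSOLUTE HODGE class in `H^{2m}` is algebraic, then every η-primitive absolute Hodge class of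
  codimension `p ≥ 2`, `2p + d = n`, on any smooth projective `X ≅ A` (`A` abelian of dimension `n`, `η` any polarisation
  class) is algebraic — induction on the defect `d`, one b02-lift per step (primitive: b02; absolute Hodge: third file;
  descent of algebraicity: b02, slice + Lieberman).
* §2 **`absoluteHodgeImpliesAlgebraicAV_iff_primitiveMiddle_of_canonical`: ROW b06 `↔` every Lefschetz-PRIMITIVE absolute
  Hodge class in the MIDDLE degree `H^{2m}` of every complex abelian variety of dimension `2m ≥ 4` (every hard Lefschetz
  datum / every polarisation class) is algebraic** (modulo (N)+(E)+(c)) — through the second file's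
  `absoluteHodgeImpliesAlgebraicAV_iff_primitive_of_canonical` and §1; the `¬`-form (a counterexample to row b06, if any,
  can be taken PRIMITIVE AND in the MIDDLE degree of an even-dimensional abelian variety of dimension `≥ 4`); (G)-keyed.
  First cell with content: an abelian FOURFOLD, `c ∈ P⁴(A, θ) = ker (θ ∪ · : H⁴ → H⁶)` absolute Hodge.
* §3 MODULI NESTED: granted c1 instead, the same equivalence is XXVIII itself read on absolute Hodge classes
  (`absoluteHodgeImpliesAlgebraicAV_iff_primitiveMiddle_of_deligne`) — the binder is the SAME on both roads, the smallest
  this axis and the AbelianAll axis have typed.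

HONEST COLUMN. Nothing is discharged; «10 · 0» unchanged; row b06, `HC_AV` are OPEN and NOT asserted; (N), (E)/(G), (c),
c1 are named facts displayed as hypotheses; no definition, no named fact, no sorry. NOT claimed: that the primitive-middle
form is strictly weaker than row b06, or anything about the GENERAL row's middle form without `B(X)` (gen 70 §4 stands).
COUNT ONCE: the lift, its primitivity and the descent are ring2-b02's; the defect induction and the `HC_AV`-level statement
are ab-spread-1's (XXVIII); the middle slice is gen 69's; this file contributes the absolute-Hodge reading.

References (bib keys): Deligne1982HodgeCycles (§2 Ex. 2.1 (c), (d) p. 16; Main Thm. 2.11 p. 19), CharlesSchnell2014Notes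
(Def. 11.2.3, Prop. 11.2.7–11.2.8, Cor. 11.2.12), VoisinHodgeI2002 (§6.2.3 Def. 6.24, Thm. 6.25, Cor. 6.26, Rem. 6.27),
Kleiman1968AlgebraicCycles (§1.4, Thm. 2A11), Lieberman1968 (main theorem), BrosnanFangNiePearlstein2009 (§6 Lemma 48),
KerrPearlstein2011 (§3.3), MumfordAV1970 (§1). -/

noncomputable section

set_option linter.dupNamespace false

open CategoryTheory AlgebraicGeometry MonoidalCategory CartesianMonoidalCategory
open Literature.AlgebraicTopology.SingularHomology Literature.Geometry.Kaehler
open Literature.AlgebraicGeometry Literature.AlgebraicGeometry.Motives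
open Literature.AlgebraicGeometry.HodgeTheory
open Summit.HodgeConjecture.HodgeConjecture.Theorems
open Summit.HodgeConjecture.HodgeConjecture.Ring2.Binders (map_mem_primitiveClasses primitiveLift_mem_primitiveClasses
  mem_algebraicClasses_of_primitiveLift_mem)

namespace Summit.HodgeConjecture.HodgeConjecture.Ring2.Hypotheses

/-! ## §1 XXVIII's defect induction read on absolute Hodge classes (modulo (N)+(E)+(c)) -/

/-- **DEFECT INDUCTION FOR ABSOLUTE HODGE CLASSES.** Granted (N), (E), (c): suppose that on every complex abelian variety
`B` of dimension `2m ≥ 4` and for every polarisation class `θ` of `B`, every θ-PRIMITIVE ABSOLUTE HODGE class in the MIDDLE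
degree `H^{2m}(B(ℂ); ℂ)` is algebraic. Then for every `d`, every smooth projective `X` of dimension `n` isomorphic to an
abelian variety, every polarisation class `η` of `X` and every `p ≥ 2` with `2p + d = n`, every η-primitive absolute Hodge
class in `H^{2p}(X(ℂ); ℂ)` is algebraic. Induction on the defect `d` exactly as in AbelianAll XXVIII
(`mem_algebraicClasses_of_mem_primitiveClasses_of_forall_primitiveMiddle`): `d = 0` by transport along `A ≅ X` (absolute
Hodge classes pull back, modulo (N)+(E)); `d = r + 1`: ring2-b02's lift on `X × E` (`E` an elliptic curve with a
polarisation class) is primitive of defect `r` (b02), ABSOLUTE HODGE (third file of this gen,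
`isAbsoluteHodgeClass_primitiveLift_of_canonical`), hence algebraic by the induction hypothesis, and algebraicity descends
(b02, slice and Lieberman's `A(X)`). [cite: Deligne1982HodgeCycles, §2 Example 2.1 (c), (d) (p. 16)]
[cite: VoisinHodgeI2002, §6.2.3 Def. 6.24, Cor. 6.26 and Rem. 6.27] [cite: Kleiman1968AlgebraicCycles, §1.4 and Thm. 2A11]
[cite: Lieberman1968, main theorem] [cite: BrosnanFangNiePearlstein2009, §6 Lemma 48] -/
theorem mem_algebraicClasses_of_absoluteHodge_primitive_of_forall_primitiveMiddle (hN : chartConjugation_canonical)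
    (hex : ∀ ⦃n : ℕ⦄ ⦃X : SchemeOver ℂ⦄, IsSmoothProjective n X →
      ∀ (σ : ℂ ≃+* ℂ) (p : ℕ) (c : complexBetti X (2 * p)), ∃ s, IsConjugateClass σ X (2 * p) c s)
    (h21c : deligne1982_lefschetz_absoluteHodge_iff)
    (hpm : ∀ (B : AbelianVariety ℂ) (m : ℕ), 2 ≤ m → B.dim = 2 * m →
      ∀ (θ : complexBetti B.X 2), IsPolarizationClass B.dim B.X θ →
        ∀ z : complexBetti B.X (2 * m), IsAbsoluteHodgeClass B.dim B.X m z →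
          z ∈ primitiveClasses θ B.dim (2 * m) → z ∈ algebraicClasses B.X m) :
    ∀ (d : ℕ) {X : SchemeOver ℂ} {n : ℕ}, IsSmoothProjective n X → ∀ (A : AbelianVariety ℂ), A.dim = n → (A.X ≅ X) →
      ∀ {η : complexBetti X 2}, IsPolarizationClass n X η → ∀ {p : ℕ}, 2 ≤ p → 2 * p + d = n →
        ∀ (c : complexBetti X (2 * p)), IsAbsoluteHodgeClass n X p c →
          c ∈ primitiveClasses η n (2 * p) → c ∈ algebraicClasses X p := by
  intro d
  induction d with
  | zero =>
    intro X n hX A hA eA η hη p h2 hn c hc hprim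
    subst hA
    have hAX : IsSmoothProjective A.dim A.X := AbelianVariety.isSmoothProjective_holds
    -- transport `c`, `η` along `eA : A ≅ X` and apply the hypothesis on `A` itself (`dim A = 2p`)
    have hz := hpm A p h2 (by omega) (complexBetti.map eA.hom 2 η) (hη.map_of_iso hX hAX eA)
      (complexBetti.map eA.hom (2 * p) c) (absolutePullback_of_canonical hN hex hAX hX eA.hom p c hc)
      (map_mem_primitiveClasses eA.hom hprim)
    exact (mem_algebraicClasses_map_iff_of_iso eA).1 hz
  | succ r ih =>
    intro X n hX A hA eA η hη p h2 hn c hc hprim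
    -- an elliptic curve `E` with a polarisation class `K_E`; `X × E ≅ (A × E).X`, of dimension `n + 1`
    obtain ⟨E, hE1⟩ := exists_abelianVariety_dim_eq_one ℂ
    have hE : IsSmoothProjective E.dim E.X := AbelianVariety.isSmoothProjective_holds
    obtain ⟨K_E, hKE⟩ := exists_isPolarizationClass hE
    have hX' : IsSmoothProjective (n + E.dim) (X ⊗ E.X) := IsSmoothProjective.tensor_holds hX hE
    have hA' : (A.prod E).dim = n + E.dim := by rw [AbelianVariety.dim_prod, hA]
    have eA' : (A.prod E).X ≅ X ⊗ E.X := whiskerRightIso eA E.X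
    have hη' := isPolarizationClass_boxSum hX hE hη hKE
    -- the b02-lift of `c` is primitive of defect `r` (b02) and ABSOLUTE HODGE (third file); the induction hypothesis applies
    have hz := ih hX' (A.prod E) hA' eA' hη' (p := p + 1) (by omega) (by omega) _
      (isAbsoluteHodgeClass_primitiveLift_of_canonical hN hex h21c hX hη E hKE hc (r + 1))
      (primitiveLift_mem_primitiveClasses E η K_E hE1 hn hprim)
    -- descend (slice `X ≅ X × {t}` and Lieberman's `A(X)` for the abelian `X`)
    exact mem_algebraicClasses_of_primitiveLift_mem E η K_E hX hA eA hη hn _ hz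

/-! ## §2 Row b06 is the algebraicity of primitive absolute Hodge classes in the middle degree of even-dimensional abelian varieties -/

/-- **ROW b06 `↔` every Lefschetz-PRIMITIVE ABSOLUTE HODGE class in the MIDDLE degree `H^{2m}` of every complex abelian
variety of dimension `2m ≥ 4`, for every hard Lefschetz datum `Λ`, is algebraic** (modulo (N)+(E)+(c)) — the absolute twin
of AbelianAll XXVIII `HC_AV_iff_forall_primitiveMiddle`: the INTERSECTION of gen 69's middle slice and the second file's
even-primitive form. `⟸`: the second file's `absoluteHodgeImpliesAlgebraicAV_iff_primitive_of_canonical` asks for the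
η-primitive absolute Hodge classes of all codimensions `2 ≤ p ≤ dim A / 2`; §1 with `d = dim A − 2p` supplies them from the
middle ones (a polarisation class IS `Λ'.hyperplaneClass` for some hard Lefschetz datum `Λ'`). Neither side is asserted.
[cite: Deligne1982HodgeCycles, §2 Example 2.1 (c), (d) (p. 16)] [cite: BrosnanFangNiePearlstein2009, §6 Lemma 48]
[cite: VoisinHodgeI2002, §6.2.3 Def. 6.24, Thm. 6.25 and Cor. 6.26] [cite: KerrPearlstein2011, §3.3] -/
theorem absoluteHodgeImpliesAlgebraicAV_iff_primitiveMiddle_of_canonical (hN : chartConjugation_canonical)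
    (hex : ∀ ⦃n : ℕ⦄ ⦃X : SchemeOver ℂ⦄, IsSmoothProjective n X →
      ∀ (σ : ℂ ≃+* ℂ) (p : ℕ) (c : complexBetti X (2 * p)), ∃ s, IsConjugateClass σ X (2 * p) c s)
    (h21c : deligne1982_lefschetz_absoluteHodge_iff) :
    AbsoluteHodgeImpliesAlgebraicAV ↔
      ∀ (A : AbelianVariety ℂ) (Λ : HardLefschetzNFold A.dim A.X) (m : ℕ), 2 ≤ m → A.dim = 2 * m →
        ∀ c : complexBetti A.X (2 * m), IsAbsoluteHodgeClass A.dim A.X m c →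
          c ∈ primitiveClasses Λ.hyperplaneClass A.dim (2 * m) → c ∈ algebraicClasses A.X m := by
  refine ⟨fun h A _ m _ _ c hc _ ↦ h A m c hc,
    fun h ↦ (absoluteHodgeImpliesAlgebraicAV_iff_primitive_of_canonical hN hex h21c).2 ?_⟩
  intro A η hη p h2 h2p c hprim hc
  have hX : IsSmoothProjective A.dim A.X := AbelianVariety.isSmoothProjective_holds
  refine mem_algebraicClasses_of_absoluteHodge_primitive_of_forall_primitiveMiddle hN hex h21c ?_ (A.dim - 2 * p) hX A
    rfl (Iso.refl A.X) hη h2 (by omega) c hc hprim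
  intro B m h2m hB θ hθ z hz hzprim
  obtain ⟨Λ', rfl⟩ := hθ.exists_hardLefschetzNFold (AbelianVariety.isSmoothProjective_holds (A := B))
  exact h B Λ' m h2m hB z hz hzprim

/-- The same with POLARISATION CLASSES `θ` in place of hard Lefschetz data. Neither side is asserted.
[cite: Deligne1982HodgeCycles, §2 Example 2.1 (c), (d) (p. 16)] [cite: VoisinHodgeI2002, Thm. 6.25 and Cor. 6.26] -/
theorem absoluteHodgeImpliesAlgebraicAV_iff_isPolarizationClass_primitiveMiddle_of_canonical
    (hN : chartConjugation_canonical)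
    (hex : ∀ ⦃n : ℕ⦄ ⦃X : SchemeOver ℂ⦄, IsSmoothProjective n X →
      ∀ (σ : ℂ ≃+* ℂ) (p : ℕ) (c : complexBetti X (2 * p)), ∃ s, IsConjugateClass σ X (2 * p) c s)
    (h21c : deligne1982_lefschetz_absoluteHodge_iff) :
    AbsoluteHodgeImpliesAlgebraicAV ↔
      ∀ (A : AbelianVariety ℂ) (m : ℕ), 2 ≤ m → A.dim = 2 * m →
        ∀ (θ : complexBetti A.X 2), IsPolarizationClass A.dim A.X θ →
          ∀ c : complexBetti A.X (2 * m), IsAbsoluteHodgeClass A.dim A.X m c →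
            c ∈ primitiveClasses θ A.dim (2 * m) → c ∈ algebraicClasses A.X m := by
  refine ⟨fun h A m _ _ θ _ c hc _ ↦ h A m c hc,
    fun h ↦ (absoluteHodgeImpliesAlgebraicAV_iff_primitiveMiddle_of_canonical hN hex h21c).2 ?_⟩
  exact fun A Λ m h2 hA c hc hprim ↦ h A m h2 hA Λ.hyperplaneClass Λ.isPolarizationClass c hc hprim

/-- **The `¬`-form: a counterexample to row b06, if any, can be taken Lefschetz-PRIMITIVE AND in the MIDDLE degree of an
even-dimensional abelian variety of dimension `≥ 4`** (modulo (N)+(E)+(c)). Neither side is asserted.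
[cite: Deligne1982HodgeCycles, §2 Example 2.1 (c), (d) (p. 16)] [cite: BrosnanFangNiePearlstein2009, §6 Lemma 48]
[cite: KerrPearlstein2011, §3.3] -/
theorem not_absoluteHodgeImpliesAlgebraicAV_iff_exists_primitiveMiddle_of_canonical (hN : chartConjugation_canonical)
    (hex : ∀ ⦃n : ℕ⦄ ⦃X : SchemeOver ℂ⦄, IsSmoothProjective n X →
      ∀ (σ : ℂ ≃+* ℂ) (p : ℕ) (c : complexBetti X (2 * p)), ∃ s, IsConjugateClass σ X (2 * p) c s)
    (h21c : deligne1982_lefschetz_absoluteHodge_iff) :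
    ¬ AbsoluteHodgeImpliesAlgebraicAV ↔
      ∃ (A : AbelianVariety ℂ) (Λ : HardLefschetzNFold A.dim A.X) (m : ℕ), 2 ≤ m ∧ A.dim = 2 * m ∧
        ∃ c : complexBetti A.X (2 * m), IsAbsoluteHodgeClass A.dim A.X m c ∧
          c ∈ primitiveClasses Λ.hyperplaneClass A.dim (2 * m) ∧ c ∉ algebraicClasses A.X m := by
  rw [absoluteHodgeImpliesAlgebraicAV_iff_primitiveMiddle_of_canonical hN hex h21c]
  push Not
  exact Iff.rfl

/-- **Row b06 `↔` its primitive-middle form, keyed to the named facts (N), (G), (c)** ((E) from Grothendieck's comparison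
fact (G) by gen 69's `exists_isConjugateClass_even_of_grothendieck`). None of (N), (G), (c) is asserted.
[cite: Deligne1982HodgeCycles, §2 Example 2.1 (c), (d) (p. 16)] [cite: CharlesSchnell2014Notes, §11.2.2 (11.2.1)–(11.2.3) and Cor. 11.2.12] -/
theorem absoluteHodgeImpliesAlgebraicAV_iff_primitiveMiddle_of_grothendieck (hN : chartConjugation_canonical)
    (hG : grothendieck_comparison_realize_surjective) (h21c : deligne1982_lefschetz_absoluteHodge_iff) :
    AbsoluteHodgeImpliesAlgebraicAV ↔
      ∀ (A : AbelianVariety ℂ) (Λ : HardLefschetzNFold A.dim A.X) (m : ℕ), 2 ≤ m → A.dim = 2 * m →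
        ∀ c : complexBetti A.X (2 * m), IsAbsoluteHodgeClass A.dim A.X m c →
          c ∈ primitiveClasses Λ.hyperplaneClass A.dim (2 * m) → c ∈ algebraicClasses A.X m :=
  absoluteHodgeImpliesAlgebraicAV_iff_primitiveMiddle_of_canonical hN (exists_isConjugateClass_even_of_grothendieck hG)
    h21c

/-! ## §3 The moduli are nested: granted c1, the same equivalence is XXVIII read on absolute Hodge classes -/

/-- **Granted Deligne's Main Theorem 2.11 (fact c1) instead of (N)+(E)+(c): row b06 `↔` its primitive-middle form is
AbelianAll XXVIII (`HC_AV_iff_forall_primitiveMiddle`, fact-free) read on absolute Hodge classes** — on an abelian variety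
"absolute Hodge" and "rational of type `(p,p)`" coincide (c1 and Charles–Schnell Def. 11.2.3 with `σ = id`), and row b06
`↔ HC_AV` (`hc_av_iff_absoluteHodgeImpliesAlgebraicAV_of_deligne`). So the binder is the same on both roads; c1 is NOT
asserted. [cite: Deligne1982HodgeCycles, Main Thm. 2.11 (p. 19)] [cite: CharlesSchnell2014Notes, Def. 11.2.3]
[cite: BrosnanFangNiePearlstein2009, §6 Lemma 48] -/
theorem absoluteHodgeImpliesAlgebraicAV_iff_primitiveMiddle_of_deligne
    (hD : deligne1982_hodgeClasses_abelianVariety_absoluteHodge) :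
    AbsoluteHodgeImpliesAlgebraicAV ↔
      ∀ (A : AbelianVariety ℂ) (Λ : HardLefschetzNFold A.dim A.X) (m : ℕ), 2 ≤ m → A.dim = 2 * m →
        ∀ c : complexBetti A.X (2 * m), IsAbsoluteHodgeClass A.dim A.X m c →
          c ∈ primitiveClasses Λ.hyperplaneClass A.dim (2 * m) → c ∈ algebraicClasses A.X m := by
  refine ⟨fun h A _ m _ _ c hc _ ↦ h A m c hc, fun h ↦ ?_⟩
  rw [← hc_av_iff_absoluteHodgeImpliesAlgebraicAV_of_deligne hD]
  exact AbelianAll.HC_AV_iff_forall_primitiveMiddle.2 fun A Λ m h2 hA c hc hpp hprim ↦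
    h A Λ m h2 hA c (hD A m c hc hpp) hprim

/-! ## Audit: nothing is decided here

No theorem above concludes `AbsoluteHodgeImpliesAlgebraicAV`, `HC_AV` or `HC_CM` outright: every statement is an
equivalence between OPEN statements or an implication with the undischarged hypothesis `hpm`; the named facts (N), (G),
(c), c1 and the existence input (E) occur only as hypotheses. Axiom closures: the three standard axioms. -/

#print axioms Summit.HodgeConjecture.HodgeConjecture.Ring2.Hypotheses.absoluteHodgeImpliesAlgebraicAV_iff_primitiveMiddle_of_canonical

end Summit.HodgeConjecture.HodgeConjecture.Ring2.Hypotheses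

end
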